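import Mathlib
import Summits.CriticalPhenomena.CardyFormulaZ2.Theorems.CardyMagicRigidityDefs
import Summits.CriticalPhenomena.CardyFormulaZ2.Theorems.CardyMagicRigidityNestingRigidityShellPotential
import HarnessLib

/-!
# Ring potentials and pair energies (line `ring-cloud-tomography`, stub S1b, parts (B)–(C))

Crux `Summit.CriticalPhenomena.CardyFormulaZ2.Theses.CardyMagicRigidity.NestingRigidity`
(stmt-CriticalPhenomena-4835), line `ring-cloud-tomography`, stub `stub_cloudEnergy : CloudEnergy`.
Using the shell formula (`CardyMagicRigidityNestingRigidityShellPotential`), this file computes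

* §1 the logarithmic potential `V(x) = ∫ log ‖x - y‖ σ_{c,L,M}(y) dy` of the uniform ring density
  `annulusDensity c L M` (`0 ≤ L < M`; the disc is the case `L = 0`): the constant
  `ringHolePotential L M` in the hole `‖x - c‖ ≤ L`, `log ‖x - c‖` outside `‖x - c‖ ≥ M`, and
  `(M² log M - M²/2 - L² log t + t²/2)/(M² - L²)` in the shell `L ≤ t = ‖x - c‖ ≤ M`;
* §2 the four PAIR ENERGIES `∫ σ_G(x) V_{G'}(x) dx` of two ring charges in mean-value position:
  self (`ringSelfEnergy`), `G` inside the hole of `G'` (`ringHolePotential` of `G'`), `G'` inside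
  the hole of `G` (`ringHolePotential` of `G`), mutually exterior (`log ‖c - c'‖`), each with the
  integrability of its integrand (needed for the bilinear expansion in the stub file).
-/

noncomputable section

open MeasureTheory Set Filter Metric Real
open scoped Real Topology BigOperators

namespace Summit.CriticalPhenomena.CardyFormulaZ2.Cruxes.NestingRigidity.RingCloudTomography

open Literature.Probability.RandomPlanarGeometry Literature.Probability.Percolation
  Literature.Probability.LatticeModels

/-! ## §1 The logarithmic potential of a ring charge -/

/-- Pulling the ring density out of the potential integral:
`∫ log ‖x - y‖ σ(y) dy = (π (M² - L²))⁻¹ ∫_{L ≤ ‖y - c‖ < M} log ‖x - y‖ dy`. -/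
theorem integral_log_mul_annulusDensity (c x : ℂ) (L M : ℝ) :
    ∫ y, Real.log ‖x - y‖ * annulusDensity c L M y =
      (π * (M ^ 2 - L ^ 2))⁻¹ * ∫ y in {z : ℂ | L ≤ ‖z - c‖ ∧ ‖z - c‖ < M}, Real.log ‖x - y‖ := by
  have h : (fun y ↦ Real.log ‖x - y‖ * annulusDensity c L M y) =
      {z : ℂ | L ≤ ‖z - c‖ ∧ ‖z - c‖ < M}.indicator
        fun y ↦ Real.log ‖x - y‖ * (π * (M ^ 2 - L ^ 2))⁻¹ := by
    funext y
    exact (indicator_mul_right _ (fun a ↦ Real.log ‖x - a‖) _).symm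
  rw [h, integral_indicator (CloudAdmissibility.measurableSet_annulus c L M), integral_mul_const,
    mul_comm]

/-- The integrand of the potential of a ring density is integrable (the logarithm is locally
integrable in the plane). -/
theorem integrable_log_mul_annulusDensity (c x : ℂ) (L M : ℝ) :
    Integrable (fun y ↦ Real.log ‖x - y‖ * annulusDensity c L M y) := by
  have h : (fun y ↦ Real.log ‖x - y‖ * annulusDensity c L M y) =
      {z : ℂ | L ≤ ‖z - c‖ ∧ ‖z - c‖ < M}.indicator
        fun y ↦ Real.log ‖x - y‖ * (π * (M ^ 2 - L ^ 2))⁻¹ := by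
    funext y
    exact (indicator_mul_right _ (fun a ↦ Real.log ‖x - a‖) _).symm
  rw [h]
  exact IntegrableOn.integrable_indicator
    ((integrableOn_log_norm_sub_annulus x c L M).integrable.mul_const _)
    (CloudAdmissibility.measurableSet_annulus c L M)

/-- **The hole value** (mean-value property of the logarithm): for `‖x - c‖ ≤ L`,
`∫ log ‖x - y‖ σ_{c,L,M}(y) dy = ringHolePotential L M`, independently of the position of `x`. -/
theorem ringPotential_of_norm_le {c x : ℂ} {L M : ℝ} (hL : 0 ≤ L) (hLM : L < M)
    (hx : ‖x - c‖ ≤ L) :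
    ∫ y, Real.log ‖x - y‖ * annulusDensity c L M y = ringHolePotential L M := by
  have hpos : 0 < M ^ 2 - L ^ 2 := by nlinarith
  rw [integral_log_mul_annulusDensity, setIntegral_annulus_log_norm_sub c x hL hLM.le,
    integral_mul_log_max_of_le hx hLM.le, integral_mul_log hL hLM.le]
  unfold ringHolePotential
  field_simp
  ring

/-- **The exterior value**: for `M ≤ ‖x - c‖`, `∫ log ‖x - y‖ σ_{c,L,M}(y) dy = log ‖x - c‖`. -/
theorem ringPotential_of_le_norm {c x : ℂ} {L M : ℝ} (hL : 0 ≤ L) (hLM : L < M)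
    (hx : M ≤ ‖x - c‖) :
    ∫ y, Real.log ‖x - y‖ * annulusDensity c L M y = Real.log ‖x - c‖ := by
  have hpos : 0 < M ^ 2 - L ^ 2 := by nlinarith
  rw [integral_log_mul_annulusDensity, setIntegral_annulus_log_norm_sub c x hL hLM.le,
    integral_mul_log_max_of_ge hx hLM.le]
  field_simp

/-- **The shell value**: for `L ≤ t = ‖x - c‖ ≤ M`,
`∫ log ‖x - y‖ σ_{c,L,M}(y) dy = (M² log M - M²/2 - L² log t + t²/2)/(M² - L²)`. -/
theorem ringPotential_of_mem {c x : ℂ} {L M : ℝ} (hL : 0 ≤ L) (hLM : L < M)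
    (hLx : L ≤ ‖x - c‖) (hxM : ‖x - c‖ ≤ M) :
    ∫ y, Real.log ‖x - y‖ * annulusDensity c L M y =
      (M ^ 2 * Real.log M - M ^ 2 / 2 - L ^ 2 * Real.log ‖x - c‖ + ‖x - c‖ ^ 2 / 2) /
        (M ^ 2 - L ^ 2) := by
  have hpos : 0 < M ^ 2 - L ^ 2 := by nlinarith
  rcases (norm_nonneg (x - c)).eq_or_lt with h0 | hpos'
  · have hL0 : L = 0 := le_antisymm (h0 ▸ hLx) hL
    rw [ringPotential_of_norm_le hL hLM (h0 ▸ hL), ← h0, hL0]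
    unfold ringHolePotential
    have hM : M ≠ 0 := by rintro rfl; linarith
    field_simp
    ring
  · rw [integral_log_mul_annulusDensity, setIntegral_annulus_log_norm_sub c x hL hLM.le,
      integral_mul_log_max_of_mem hpos' hLx hxM]
    field_simp
    ring

/-! ## §2 Pair energies of two ring charges in mean-value position -/

/-- Pulling the ring density out of an outer integral:
`∫ σ_{c,L,M}(x) g(x) dx = (π (M² - L²))⁻¹ ∫_{L ≤ ‖x - c‖ < M} g`. -/
theorem integral_annulusDensity_mul (c : ℂ) (L M : ℝ) (g : ℂ → ℝ) :
    ∫ x, annulusDensity c L M x * g x =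
      (π * (M ^ 2 - L ^ 2))⁻¹ * ∫ x in {z : ℂ | L ≤ ‖z - c‖ ∧ ‖z - c‖ < M}, g x := by
  have h : (fun x ↦ annulusDensity c L M x * g x) =
      {z : ℂ | L ≤ ‖z - c‖ ∧ ‖z - c‖ < M}.indicator fun x ↦ (π * (M ^ 2 - L ^ 2))⁻¹ * g x := by
    funext x
    exact (indicator_mul_left _ _ g).symm
  rw [h, integral_indicator (CloudAdmissibility.measurableSet_annulus c L M), integral_const_mul]

/-- `σ_{c,L,M} · g` is integrable as soon as `g` is integrable on the annulus. -/
theorem integrable_annulusDensity_mul {c : ℂ} {L M : ℝ} {g : ℂ → ℝ}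
    (hg : IntegrableOn g {z : ℂ | L ≤ ‖z - c‖ ∧ ‖z - c‖ < M}) :
    Integrable (fun x ↦ annulusDensity c L M x * g x) := by
  have h : (fun x ↦ annulusDensity c L M x * g x) =
      {z : ℂ | L ≤ ‖z - c‖ ∧ ‖z - c‖ < M}.indicator fun x ↦ (π * (M ^ 2 - L ^ 2))⁻¹ * g x := by
    funext x
    exact (indicator_mul_left _ _ g).symm
  rw [h]
  exact IntegrableOn.integrable_indicator (hg.integrable.const_mul _)
    (CloudAdmissibility.measurableSet_annulus c L M)

/-- **Pair energy, `G` in the hole of `G'`** (`‖c - c'‖ + M ≤ L'`): the potential of `G'` is the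
constant `ringHolePotential L' M'` on the carrier of `G`, so
`∫ σ_G V_{G'} = ringHolePotential L' M'`. -/
theorem pairEnergy_of_inside {c c' : ℂ} {L M L' M' : ℝ} (hL : 0 ≤ L) (hLM : L < M) (hL' : 0 ≤ L')
    (hLM' : L' < M') (h : ‖c - c'‖ + M ≤ L') :
    Integrable (fun x ↦ annulusDensity c L M x *
        ∫ y, Real.log ‖x - y‖ * annulusDensity c' L' M' y) ∧
      ∫ x, annulusDensity c L M x * ∫ y, Real.log ‖x - y‖ * annulusDensity c' L' M' y =
        ringHolePotential L' M' := by
  have hpos : 0 < M ^ 2 - L ^ 2 := by nlinarith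
  have hV : ∀ x ∈ {z : ℂ | L ≤ ‖z - c‖ ∧ ‖z - c‖ < M},
      ∫ y, Real.log ‖x - y‖ * annulusDensity c' L' M' y = ringHolePotential L' M' := by
    intro x hx
    apply ringPotential_of_norm_le hL' hLM'
    calc ‖x - c'‖ ≤ ‖x - c‖ + ‖c - c'‖ := norm_sub_le_norm_sub_add_norm_sub _ _ _
      _ ≤ L' := by linarith [hx.2]
  have hint : IntegrableOn (fun x ↦ ∫ y, Real.log ‖x - y‖ * annulusDensity c' L' M' y)
      {z : ℂ | L ≤ ‖z - c‖ ∧ ‖z - c‖ < M} :=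
    (integrableOn_annulus_of_continuousOn continuousOn_const).congr_fun
      (fun x hx ↦ (hV x hx).symm) (CloudAdmissibility.measurableSet_annulus c L M)
  refine ⟨integrable_annulusDensity_mul hint, ?_⟩
  rw [integral_annulusDensity_mul,
    setIntegral_congr_fun (CloudAdmissibility.measurableSet_annulus c L M) hV,
    setIntegral_const, CloudAdmissibility.volume_real_annulus c hL hLM.le, smul_eq_mul]
  field_simp

/-- **Pair energy, `G'` in the hole of `G`** (`‖c' - c‖ + M' ≤ L`): on the carrier of `G` the
potential of `G'` is `log ‖x - c'‖`, whose `σ_G`-average is the hole value of `G` at `c'`: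
`∫ σ_G V_{G'} = ringHolePotential L M`. -/
theorem pairEnergy_of_contains {c c' : ℂ} {L M L' M' : ℝ} (hL : 0 ≤ L) (hLM : L < M)
    (hL' : 0 ≤ L') (hLM' : L' < M') (h : ‖c' - c‖ + M' ≤ L) :
    Integrable (fun x ↦ annulusDensity c L M x *
        ∫ y, Real.log ‖x - y‖ * annulusDensity c' L' M' y) ∧
      ∫ x, annulusDensity c L M x * ∫ y, Real.log ‖x - y‖ * annulusDensity c' L' M' y =
        ringHolePotential L M := by
  have hpos : 0 < M ^ 2 - L ^ 2 := by nlinarith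
  have hV : ∀ x ∈ {z : ℂ | L ≤ ‖z - c‖ ∧ ‖z - c‖ < M},
      ∫ y, Real.log ‖x - y‖ * annulusDensity c' L' M' y = Real.log ‖c' - x‖ := by
    intro x hx
    rw [ringPotential_of_le_norm hL' hLM', norm_sub_rev]
    have h1 : ‖x - c‖ - ‖c' - c‖ ≤ ‖(x - c) - (c' - c)‖ := norm_sub_norm_le _ _
    rw [sub_sub_sub_cancel_right] at h1
    linarith [hx.1]
  have hint : IntegrableOn (fun x ↦ ∫ y, Real.log ‖x - y‖ * annulusDensity c' L' M' y)
      {z : ℂ | L ≤ ‖z - c‖ ∧ ‖z - c‖ < M} :=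
    (integrableOn_log_norm_sub_annulus c' c L M).congr_fun (fun x hx ↦ (hV x hx).symm)
      (CloudAdmissibility.measurableSet_annulus c L M)
  refine ⟨integrable_annulusDensity_mul hint, ?_⟩
  have hc' : ‖c' - c‖ ≤ L := by linarith
  rw [integral_annulusDensity_mul,
    setIntegral_congr_fun (CloudAdmissibility.measurableSet_annulus c L M) hV,
    setIntegral_annulus_log_norm_sub c c' hL hLM.le, integral_mul_log_max_of_le hc' hLM.le,
    integral_mul_log hL hLM.le]
  unfold ringHolePotential
  field_simp
  ring

/-- **Pair energy, mutually exterior rings** (`M + M' ≤ ‖c - c'‖`): on the carrier of `G` the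
potential of `G'` is `log ‖x - c'‖`, whose `σ_G`-average is `log ‖c - c'‖`. -/
theorem pairEnergy_of_exterior {c c' : ℂ} {L M L' M' : ℝ} (hL : 0 ≤ L) (hLM : L < M)
    (hL' : 0 ≤ L') (hLM' : L' < M') (h : M + M' ≤ ‖c - c'‖) :
    Integrable (fun x ↦ annulusDensity c L M x *
        ∫ y, Real.log ‖x - y‖ * annulusDensity c' L' M' y) ∧
      ∫ x, annulusDensity c L M x * ∫ y, Real.log ‖x - y‖ * annulusDensity c' L' M' y =
        Real.log ‖c - c'‖ := by
  have hpos : 0 < M ^ 2 - L ^ 2 := by nlinarith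
  have hV : ∀ x ∈ {z : ℂ | L ≤ ‖z - c‖ ∧ ‖z - c‖ < M},
      ∫ y, Real.log ‖x - y‖ * annulusDensity c' L' M' y = Real.log ‖c' - x‖ := by
    intro x hx
    rw [ringPotential_of_le_norm hL' hLM', norm_sub_rev]
    have h1 : ‖c - c'‖ - ‖c - x‖ ≤ ‖(c - c') - (c - x)‖ := norm_sub_norm_le _ _
    rw [sub_sub_sub_cancel_left, norm_sub_rev c x] at h1
    linarith [hx.2]
  have hint : IntegrableOn (fun x ↦ ∫ y, Real.log ‖x - y‖ * annulusDensity c' L' M' y)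
      {z : ℂ | L ≤ ‖z - c‖ ∧ ‖z - c‖ < M} :=
    (integrableOn_log_norm_sub_annulus c' c L M).congr_fun (fun x hx ↦ (hV x hx).symm)
      (CloudAdmissibility.measurableSet_annulus c L M)
  refine ⟨integrable_annulusDensity_mul hint, ?_⟩
  have hc' : M ≤ ‖c' - c‖ := by rw [norm_sub_rev]; linarith
  rw [integral_annulusDensity_mul,
    setIntegral_congr_fun (CloudAdmissibility.measurableSet_annulus c L M) hV,
    setIntegral_annulus_log_norm_sub c c' hL hLM.le, integral_mul_log_max_of_ge hc' hLM.le,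
    norm_sub_rev]
  field_simp

/-- **Self-energy of a ring**: `∫ σ_G V_G = ringSelfEnergy L M` (radial integration of the shell
value of the potential; for `L = 0` this is the disc self-energy `log M - 1/4`). -/
theorem pairEnergy_self {c : ℂ} {L M : ℝ} (hL : 0 ≤ L) (hLM : L < M) :
    Integrable (fun x ↦ annulusDensity c L M x *
        ∫ y, Real.log ‖x - y‖ * annulusDensity c L M y) ∧
      ∫ x, annulusDensity c L M x * ∫ y, Real.log ‖x - y‖ * annulusDensity c L M y =
        ringSelfEnergy L M := by
  have hpos : 0 < M ^ 2 - L ^ 2 := by nlinarith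
  have hAm := CloudAdmissibility.measurableSet_annulus c L M
  have hV : ∀ x ∈ {z : ℂ | L ≤ ‖z - c‖ ∧ ‖z - c‖ < M},
      ∫ y, Real.log ‖x - y‖ * annulusDensity c L M y =
        ((M ^ 2 * Real.log M - M ^ 2 / 2 - L ^ 2 * Real.log ‖c - x‖) + ‖x - c‖ ^ 2 / 2) /
          (M ^ 2 - L ^ 2) := by
    intro x hx
    rw [ringPotential_of_mem hL hLM hx.1 hx.2.le, norm_sub_rev c x]
  -- integrability of the three pieces of the shell value on the annulus
  have hI0 : IntegrableOn (fun _ : ℂ ↦ M ^ 2 * Real.log M - M ^ 2 / 2)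
      {z : ℂ | L ≤ ‖z - c‖ ∧ ‖z - c‖ < M} :=
    integrableOn_annulus_of_continuousOn continuousOn_const
  have hI1 : IntegrableOn (fun x : ℂ ↦ L ^ 2 * Real.log ‖c - x‖)
      {z : ℂ | L ≤ ‖z - c‖ ∧ ‖z - c‖ < M} :=
    ((integrableOn_log_norm_sub_annulus c c L M).integrable.const_mul _)
  have hI2 : IntegrableOn (fun x : ℂ ↦ ‖x - c‖ ^ 2 / 2) {z : ℂ | L ≤ ‖z - c‖ ∧ ‖z - c‖ < M} :=
    (integrableOn_annulus_of_continuousOn (by fun_prop)).integrable.div_const _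
  have hI01 : IntegrableOn (fun x : ℂ ↦ M ^ 2 * Real.log M - M ^ 2 / 2 - L ^ 2 * Real.log ‖c - x‖)
      {z : ℂ | L ≤ ‖z - c‖ ∧ ‖z - c‖ < M} := hI0.sub hI1
  have hI012 : IntegrableOn (fun x : ℂ ↦
      (M ^ 2 * Real.log M - M ^ 2 / 2 - L ^ 2 * Real.log ‖c - x‖) + ‖x - c‖ ^ 2 / 2)
        {z : ℂ | L ≤ ‖z - c‖ ∧ ‖z - c‖ < M} := hI01.add hI2
  have hI : IntegrableOn (fun x : ℂ ↦
      ((M ^ 2 * Real.log M - M ^ 2 / 2 - L ^ 2 * Real.log ‖c - x‖) + ‖x - c‖ ^ 2 / 2) /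
        (M ^ 2 - L ^ 2)) {z : ℂ | L ≤ ‖z - c‖ ∧ ‖z - c‖ < M} := hI012.div_const _
  have hint : IntegrableOn (fun x ↦ ∫ y, Real.log ‖x - y‖ * annulusDensity c L M y)
      {z : ℂ | L ≤ ‖z - c‖ ∧ ‖z - c‖ < M} :=
    hI.congr_fun (fun x hx ↦ (hV x hx).symm) hAm
  refine ⟨integrable_annulusDensity_mul hint, ?_⟩
  have hlog : ∫ x in {z : ℂ | L ≤ ‖z - c‖ ∧ ‖z - c‖ < M}, Real.log ‖c - x‖ =
      2 * π * ((M ^ 2 / 2 * Real.log M - M ^ 2 / 4) - (L ^ 2 / 2 * Real.log L - L ^ 2 / 4)) := by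
    rw [setIntegral_annulus_log_norm_sub c c hL hLM.le, sub_self, norm_zero,
      integral_mul_log_max_of_le hL hLM.le, integral_mul_log hL hLM.le]
  rw [integral_annulusDensity_mul, setIntegral_congr_fun hAm hV, integral_div,
    integral_add hI01 hI2, integral_sub hI0 hI1, integral_const_mul, integral_div,
    setIntegral_const, CloudAdmissibility.volume_real_annulus c hL hLM.le, smul_eq_mul, hlog,
    setIntegral_annulus_norm_sq c hL hLM.le]
  unfold ringSelfEnergy
  field_simp
  ring

/-- **Ring self-energy** (registered sub-goal form of `pairEnergy_self`): for `0 ≤ L < M`,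
`∫ σ_{c,L,M}(x) (∫ log ‖x - y‖ σ_{c,L,M}(y) dy) dx = ringSelfEnergy L M`. -/
theorem ringSelfEnergy_eq : ∀ (c : ℂ) (L M : ℝ), 0 ≤ L → L < M →
    ∫ x, annulusDensity c L M x * ∫ y, Real.log ‖x - y‖ * annulusDensity c L M y =
      ringSelfEnergy L M :=
  fun _ _ _ hL hLM ↦ (pairEnergy_self hL hLM).2

end Summit.CriticalPhenomena.CardyFormulaZ2.Cruxes.NestingRigidity.RingCloudTomography

end
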